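/- Copyright: the b2b-balaban cell (near-miss cell 7), T⁴-continuum fan-out, lineage t4-ne7b-p1 (node U5c COUNT
member).  Released under the licence of the surrounding project. -/
import Summits.QuantumFields.BalabanUV.T4Continuum.Support.HistoryBankingFlatJunction
import Summits.QuantumFields.BalabanUV.T4Continuum.Support.HistoryGenAdm

/-!
# M5-2a — THE FLAT LEDGER IN THE END's OWN VARIABLES: a live component `c` of a term's `Pedigree`, its tagged
genealogy `genT c` (shape map `Prod.fst`) over its geometric pedigree `toPGen cell c` (owner module of row NE7b, lineage
`t4-ne7b-p1` gen 43; re-open object (α), `SCOPE-alpha.md` v2.6, ruling R-OWNER-43-1; the first brick of M5-2 «the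
witness plug»; PRE-POSITIONING ONLY)

Summits-side support leaf of the T⁴-continuum cell (rung (B)+1 on a FINITE torus only; NOT infinite volume, NOT the
mass gap, NOT the Clay statement; NOT a proof of the spine estimate NE7b — the cell's OWN estimate, NOT PRINTED, NOT
PROVED).  [folklore] bookkeeping: the shape-invariance of the tagged tables (`T4BranchingRecordsGas.shape`,
`T4TaggedShapeBanking.dictW_shape`; `wt`∕`fw`∕`supp`∕`sz`∕`wfloor`∕`costT` read a label only through its step, kind and —
for births — class) and the bridge `HistoryGen.Pedigree.shape_genT_eq_toGen` (`relabel (shape ∘ Prod.fst) (genT c) =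
(toPGen cell c).toGen`, leaf-09's «S3 exports») applied to the assembly `HistoryBankingFlatJunction.flat_volume_le_lifeCost`;
nothing printed is asserted, no `def`, no cite-tagged hypothesis, zero `sorry`.

WHAT.  §1 `dictWT_shape_comp`, `wt_shape`, `fw_shape`, `sz_shape`, `costT_shape_comp`, `lifeCost_shape_comp`: composing
the shape map with `shape` changes neither the window table nor the booked cost.  §2 **`flat_volume_le_lifeCost_genT`**:
for a `HistoryGen.Pedigree` whose renewed parts come from the previous step (`renew_step`, the END's `Timed` clause) and
a component `c` whose geometric pedigree `toPGen cell c` is `RealisesW`-realised and observed by the cutoff, whose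
tagged genealogy `genT c` is well formed for the run's table and pending at `K`, under the calibrated displays of the
assembly: `Σ_{m≤K} u_m·compSum id (toPGen cell c) m ≤ lifeCost (dictWT Prod.fst R C.n₁) (costT Prod.fst C K R) (genT c)
+ 2^{d+3}·blin u (toPGen cell c)` — the right-hand side is LITERALLY the booked life cost the W-T witness's `cost_le`
names (`q.2 = (ped K τ).genT c`, `sh = Prod.fst`, `padW … 0` being the table itself).

WHAT IS *NOT* DONE HERE.  M5-2b∕c: the volume inequality from M2-B's per-(level, component) factor `Λ K j ^ #c.2` to
`exp (Σ_m (log Λ K m)·compSum id (toPGen … c) m)` over the pass-V objects, and `priceM` with `κ := costT` through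
`HistoryConstantsTH.le_prod_shapeTH_of_slack`.  HONEST: bookkeeping; NE7b NOT proved; spine 0∕9.  HONEST DEPENDENCY
(cell): continuum YM on T⁴ ⇐ BetaPertH ∧ nine spine estimates (0∕9 proved); BetaPertH ⇐ (D1) ∧ (D4) ∧ CAP+tail.
-/

open Finset
open Literature.MathematicalPhysics.QuantumFieldTheory.Balaban1983to89
open Literature.MathematicalPhysics.QuantumFieldTheory.Balaban1983to89.B13ScaleTransfer
open Literature.MathematicalPhysics.QuantumFieldTheory.Balaban1983to89.B16SProfile
open T4PersistenceDictionary T4PrintedShapeBanking T4TaggedShapeBanking T4BankedInduction T4BranchingRecordsGas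
open Summit.QuantumFields.BalabanUV.T4Continuum.HistoryAdmissible
open Summit.QuantumFields.BalabanUV.T4Continuum.HistoryRealise
open Summit.QuantumFields.BalabanUV.T4Continuum.HistoryRealiseWeak
open Summit.QuantumFields.BalabanUV.T4Continuum.HistoryGen
open Summit.QuantumFields.BalabanUV.T4Continuum.HistoryBankingPedigreeLedger
open Summit.QuantumFields.BalabanUV.T4Continuum.HistoryBankingBirthBookings
open Summit.QuantumFields.BalabanUV.T4Continuum.HistoryBankingFlatJunction

namespace Summit.QuantumFields.BalabanUV.T4Continuum.HistoryBankingFlatWitness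

noncomputable section

variable {d : ℕ} {ε : Type*} [DecidableEq ε]

/-! ## §1 The tagged tables are blind to `shape` -/

section Shape

variable (C : T4PrintedShapeBanking.Consts) (K : ℕ) (R : ℕ → ℕ)

omit [DecidableEq ε] in
/-- composing the shape map with `shape` keeps the tagged window table [folklore] -/
theorem dictWT_shape_comp (sh : ε → PEv) (n₁ : ℕ) : dictWT (shape ∘ sh) R n₁ = dictWT sh R n₁ :=
  funext fun e => dictW_shape R n₁ (sh e)

/-- the size weight is blind to `shape` [folklore] -/
theorem wt_shape (e : PEv) : wt C (shape e) = wt C e := by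
  unfold wt
  by_cases h0 : e.kind = 0
  · rw [if_pos (by rw [kind_shape]; exact h0), if_pos h0, fat_shape_of_kind0 h0]
  · rw [if_neg (by rw [kind_shape]; exact h0), if_neg h0, kind_shape]

/-- the size epoch length is blind to `shape` [folklore] -/
theorem fw_shape (e : PEv) : fw C (shape e) = fw C e := by
  unfold fw
  by_cases h0 : e.kind = 0
  · rw [if_pos (by rw [kind_shape]; exact h0), if_pos h0, fat_shape_of_kind0 h0]
  · rw [if_neg (by rw [kind_shape]; exact h0), if_neg h0, kind_shape]

/-- the size cost is blind to `shape` [folklore] -/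
theorem sz_shape (e : PEv) (n : ℕ) : sz C K R (shape e) n = sz C K R e n := by
  unfold sz supp
  rw [fw_shape, wt_shape, step_shape]

/-- **THE BOOKED COST IS BLIND TO `shape`**: `costT (shape ∘ sh) = costT sh`. [folklore] -/
theorem costT_shape_comp (sh : ε → PEv) (G : Gen ε) (n : ℕ) :
    costT (shape ∘ sh) C K R G n = costT sh C K R G n := by
  unfold costT
  rw [dictWT_shape_comp]
  refine Finset.sum_congr rfl fun e _ => ?_
  simp only [Function.comp_apply]
  rw [sz_shape]
  unfold wfloor
  rw [dictW_shape]

/-- hence so is the booked life cost [folklore] -/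
theorem lifeCost_shape_comp (sh : ε → PEv) (G : Gen ε) :
    lifeCost (dictWT (shape ∘ sh) R C.n₁) (costT (shape ∘ sh) C K R) G = lifeCost (dictWT sh R C.n₁) (costT sh C K R) G := by
  unfold lifeCost life
  rw [dictWT_shape_comp]
  exact Finset.sum_congr rfl fun n _ => costT_shape_comp C K R sh G n

end Shape

/-! ## §2 The headline in the END's variables -/

section Headline

variable {L : ℕ} {s R : ℕ → ℕ} {C : T4PrintedShapeBanking.Consts} {α π : Type*} [DecidableEq α] [DecidableEq π]

/-- **THE FLAT LEDGER FOR A LIVE COMPONENT OF A TERM's PEDIGREE** (ruling R-OWNER-43-1; M5-2a).  For a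
`HistoryGen.Pedigree` `Pd` with `renew_step` (renewed parts from the previous step), a root-data reading `cell`, a
component `c` whose geometric pedigree `Pd.toPGen cell c` is `RealisesW`-realised and observed by the cutoff
(`lastStep ≤ K`), and whose tagged genealogy `Pd.genT c` is well formed for the run's table `dictWT Prod.fst R C.n₁` and
pending at `K`; flow `L ≥ 4` with drop control, sizes `R ≥ 1`, `13 ≤ C.n₁`, `0 ≤ E₂, E₃`; unit costs `u ≥ 0` with the
growth display, a lag `j ≥ 1` with `1122^d·16·21^d·L_u ≤ 2^j∕2`, and the calibrated displays:
`Σ_{m≤K} u_m·compSum id (Pd.toPGen cell c) m ≤ lifeCost (dictWT Prod.fst R C.n₁) (costT Prod.fst C K R) (Pd.genT c)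
+ 2^{d+3}·blin u (Pd.toPGen cell c)`. [folklore] -/
theorem flat_volume_le_lifeCost_genT (hL : 4 ≤ L) (hdrop : ∀ m, DropCtl s m) (hR : ∀ t, 1 ≤ R t)
    (hn₁ : 13 ≤ C.n₁) (hE₂ : 0 ≤ C.E₂) (hE₃ : 0 ≤ C.E₃) (Pd : Pedigree α π)
    (cell : π → Pt d × Finset (Pt d)) (hS : ∀ c c', Part.old c' true ∈ Pd.parts c → Pd.step c' + 1 = Pd.step c)
    (c : α) {Z : Finset (Pt d)} (hP : RealisesW L s R (Pd.toPGen cell c) Z)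
    (hW : (Pd.genT c).WF (dictWT Prod.fst R C.n₁)) {K : ℕ} (hPK : (Pd.toPGen cell c).lastStep ≤ K)
    (hK : K < (Pd.genT c).reach (dictWT Prod.fst R C.n₁)) {u : ℕ → ℝ} (hu : ∀ n, 0 ≤ u n) {Lu : ℝ}
    (hLu0 : 0 < Lu) {j : ℕ} (hj1 : 1 ≤ j) (hLu : ∀ t i, i ≤ j → u (t + i) ≤ Lu * u t)
    (hsmall : (1122 : ℝ) ^ d * 16 * 21 ^ d * Lu ≤ 2 ^ j / 2)
    (huΦ : ∀ t, t ≤ K → u t * (6 * (561 ^ d * j * Lu + 1122 ^ d * Lu)) ≤ floorK C K R t)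
    (huE₂ : ∀ n, n ≤ K → u n * (15 * 126 ^ d) ≤ C.E₂ * (R n : ℝ) ^ C.q')
    (huE₃ : ∀ n, n ≤ K → u n * (24 * 126 ^ d) ≤ C.E₃ * (R n : ℝ) ^ C.q') :
    ∑ m ∈ Finset.range (K + 1), u m * compSum L s (fun v => (v : ℝ)) (Pd.toPGen cell c) m ≤
      lifeCost (dictWT Prod.fst R C.n₁) (costT Prod.fst C K R) (Pd.genT c) + 2 ^ (d + 3) * blin u (Pd.toPGen cell c) := by
  classical
  have hsh : relabel (shape ∘ Prod.fst) (Pd.genT c) = (Pd.toPGen cell c).toGen := Pd.shape_genT_eq_toGen cell hS c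
  have hW' : (Pd.genT c).WF (dictWT (shape ∘ Prod.fst) R C.n₁) := by rw [dictWT_shape_comp]; exact hW
  have hK' : K < (Pd.genT c).reach (dictWT (shape ∘ Prod.fst) R C.n₁) := by rw [dictWT_shape_comp]; exact hK
  have h := flat_volume_le_lifeCost (sh := shape ∘ Prod.fst) hL hdrop hR hn₁ hE₂ hE₃ hP hsh hW' hPK hK' hu hLu0 hj1
    hLu hsmall huΦ huE₂ huE₃
  rwa [lifeCost_shape_comp] at h

end Headline

end

end Summit.QuantumFields.BalabanUV.T4Continuum.HistoryBankingFlatWitness
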